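import Summits.ResolutionOfSingularities.ResolutionOfSingularities.Theorems.MarkedTransferCampaignW36EquiInvOnClass
import Literature.AlgebraicGeometry.Hironaka2017.Lib.RegularCentreCodim
import HarnessLib

/-!
# [OURS · L1 W3.6 ↔ GAP-LEDGER R20 sub 20b(ii) / R49·T] `CampaignW36.EquiInvLocAt` (p511607) IN THE RÉSUMÉ'S SLOT SHAPE AND IN THE GLOBAL READING —
# H:hEquiCheckLoc VERBATIM (`kit.inv := S16Proof.invOfChoice(Bot) c`) ⟺ `EquiInvLocAt` ⟺ ⟨SingRegular(Ě)⟩ at every typed core focus of a class member, with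
# NO I:`dim Z = n` binder; and the literal «one value on all of `Sing(Ě)_cl`» clause of Eq. (125) from ⟨SingRegular(Ě)⟩ + constant codimension / irreducible `Sing(Ě)`

Cell `res-hironaka`, rung L (rescue), row L-G3, slot W3.6 ↔ GAP-LEDGER R20 (20b(ii)) / R49·T. Typed by the OURS typer o4 (statement-only lane); kernel plumbing
only (0 definitions), companion of p511607 `…W36EquiInvOnClass` per res-adj-3 GO 2026-08-27T07:38:46Z riders (R3) «global form: optional, a READING of (125)'s literal
clause — NOT a G3 modulus, no `_holds` door» and (R4) «§slot welcome». HOST: `--supports stmt-ResolutionOfSingularities-16155 --as helper`.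
* §1 SLOT ⟺ DATA-READ. For any point function `kinv` reading `inv` off every R1 datum at the closed singular points (`hk`; e.g. the résumé slots
  `S16Proof.invOfChoice c` / `invOfChoiceBot c`, binder-free by `invOfChoice(Bot)_eq_inv_of_isEdgeData`), the résumé binder H:hEquiCheckLoc at one stage
  «∀ closed ξ ∈ Sing Ě, ∃ U open ∋ ξ, ∀ closed η ∈ Sing Ě ∩ U, kinv Ě η = kinv Ě ξ» (p501944 / p502750 / p504681 / p509626 shape VERBATIM) IMPLIES
  `EquiInvLocAt CampaignW31.edgeDataProvenance A n Ě` (`equiInvLocAt_of_slot`), and conversely given R1 data at the closed singular points (`Ě` standard,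
  `μ(max 𝒪_ξ) = n` on `Sing(Ě)_cl`, perfect `K`: `slot_of_equiInvLocAt`); on a class member `(E, ed)` at `IsCoreFocus_inst Ê Ě ed` both guards are read off the
  member (p511607 `spanFinrank_maximalIdeal_eq_of_isCoreFocus`, `isStandard_of_isCoreFocus_baseHike`): **`slot_invOfChoiceBot_iff_equiInvLocAt_of_isCoreFocus_inst`**,
  **`slot_invOfChoiceBot_iff_isRegular_sing_of_isCoreFocus_inst`** (+ `invOfChoice` twins) — p506310 §3's `hn : dim Z = n` is not needed on class members.
* §2 GLOBAL READING (labelled [reading]; no def, no door): the one-value clause «∀ closed ξ ξ₂ ∈ Sing Ě, ∀ R1 data, inv D_ξ = inv D_ξ₂» implies `EquiInvLocAt`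
  (`equiInvLocAt_of_forall_inv_eq`, `U := ⊤`); conversely ⟨SingRegular(Ě)⟩ + «`ht 𝓘_{Sing Ě, ξ}` constant over closed ξ» gives it (p506310
  `inv_eq_inv_of_height_eq_of_isCoreFocus_of_isRegular`), and the side-datum is automatic when `Sing(Ě)` is IRREDUCIBLE (res-D-pv-050
  `height_stalkIdeal_vanishingIdeal_eq_of_isIrreducible`, Lib/RegularCentreCodim): `forall_inv_eq_of_isRegular_sing_of_isIrreducible`.
HONEST FRAMING. Kernel plumbing over OUR typed carriers and slots; NOTHING here is a statement of H. Hironaka's manuscript (2017-03-23, [Hironaka2017], lit key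
`paper:url-3343fd9e678b`), which stays «under review»; nothing asserts Eq. (125) p.78 as printed. AI typing, weaker than expert review.
Reference (context only, not a premise): H. Hironaka, ms. 2017-03-23, Eq. (34) p.24; Eq. (43) p.30; Def. 15.1 p.75; Eq. (125) p.78; Th. 16.6 (3) p.84. [Hironaka2017]
-/

noncomputable section

set_option linter.dupNamespace false -- mandated namespace of this single-conjunct summit

open _root_.AlgebraicGeometry _root_.TopologicalSpace
namespace Summit.ResolutionOfSingularities.ResolutionOfSingularities.Theorems

open Literature.AlgebraicGeometry.Resolution Literature.AlgebraicGeometry.Hironaka2017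
open Literature.AlgebraicGeometry.Hironaka2017.S02Preliminaries Literature.AlgebraicGeometry.Hironaka2017.S04CharAlgebra
open Literature.AlgebraicGeometry.Hironaka2017.S06BaseHike Literature.AlgebraicGeometry.Hironaka2017.Datum
open Scheme.IdealSheafData IsLocalRing

universe u

namespace CampaignW36

/-! ## §1 The résumé's slot shape ⟺ the data-read shape -/
section Slot

variable {p : ℕ} [Fact p.Prime] {K : Type u} [Field K] [CharP K p] {n : ℕ}

/-- **SLOT ⇒ DATA-READ, no hypothesis on `Ě`**: if a point function `kinv` reads `inv` off every R1 datum at the closed points of `Sing(Ě)` (`hk`) and satisfies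
the résumé binder H:hEquiCheckLoc at `Ě` (shape of p501944 / p509626 verbatim), then `EquiInvLocAt CampaignW31.edgeDataProvenance A n Ě`. Kernel plumbing;
NOT a statement of the manuscript. [folklore] -/
theorem equiInvLocAt_of_slot (A : AmbientDatum p K) (kinv : IdealExponent A.Z → A.Z → EdgeInv n) (Echeck : IdealExponent A.Z)
    (hk : ∀ (η : A.Z), η ∈ Echeck.sing → η ∈ S02Preliminaries.closedPoints A.Z →
      ∀ D : EdgeDatumAt p n Echeck η, S04CharAlgebra.IsEdgeData D → kinv Echeck η = S04CharAlgebra.inv D)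
    (h : ∀ ξ ∈ Echeck.sing, IsClosed ({ξ} : Set A.Z) → ∃ U : Set A.Z, IsOpen U ∧ ξ ∈ U ∧
      ∀ η ∈ Echeck.sing ∩ U, IsClosed ({η} : Set A.Z) → kinv Echeck η = kinv Echeck ξ) :
    EquiInvLocAt CampaignW31.edgeDataProvenance A n Echeck := by
  intro ξ hξ hξcl
  obtain ⟨U, hU, hξU, hUeq⟩ := h ξ hξ hξcl
  refine ⟨⟨U, hU⟩, hξU, fun η hηU hηcl hη Dη hDη Dξ hDξ => ?_⟩
  rw [← hk η hη hηcl Dη hDη, ← hk ξ hξ hξcl Dξ hDξ]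
  exact hUeq η ⟨hη, hηU⟩ hηcl

/-- **DATA-READ ⇒ SLOT, given R1 data at the closed singular points** (perfect `K`, `Ě` standard, `μ(max 𝒪_ξ) = n` on `Sing(Ě)_cl` — the POINTWISE guard, not
I:`dim Z = n`; data by `S16Proof.exists_isEdgeData_ambient`): `EquiInvLocAt` at R1 gives H:hEquiCheckLoc at `Ě` for every `kinv` reading `inv` off R1 data.
Kernel plumbing; NOT a statement of the manuscript. [folklore] -/
theorem slot_of_equiInvLocAt [PerfectField K] (A : AmbientDatum p K) (kinv : IdealExponent A.Z → A.Z → EdgeInv n)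
    (Echeck : IdealExponent A.Z) (hstd : Echeck.IsStandard)
    (hμ : ∀ ξ ∈ Echeck.sing ∩ S02Preliminaries.closedPoints A.Z, (maximalIdeal (A.Z.presheaf.stalk ξ)).spanFinrank = n)
    (hk : ∀ (η : A.Z), η ∈ Echeck.sing → η ∈ S02Preliminaries.closedPoints A.Z →
      ∀ D : EdgeDatumAt p n Echeck η, S04CharAlgebra.IsEdgeData D → kinv Echeck η = S04CharAlgebra.inv D)
    (h : EquiInvLocAt CampaignW31.edgeDataProvenance A n Echeck) :
    ∀ ξ ∈ Echeck.sing, IsClosed ({ξ} : Set A.Z) → ∃ U : Set A.Z, IsOpen U ∧ ξ ∈ U ∧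
      ∀ η ∈ Echeck.sing ∩ U, IsClosed ({η} : Set A.Z) → kinv Echeck η = kinv Echeck ξ := by
  intro ξ hξ hξcl
  obtain ⟨U, hξU, hU⟩ := h ξ hξ hξcl
  obtain ⟨Dξ, hDξ⟩ := S16Proof.exists_isEdgeData_ambient A Echeck hstd ξ hξ hξcl (hμ ξ ⟨hξ, hξcl⟩)
  refine ⟨U, U.isOpen, hξU, fun η hη hηcl => ?_⟩
  obtain ⟨Dη, hDη⟩ := S16Proof.exists_isEdgeData_ambient A Echeck hstd η hη.1 hηcl (hμ η ⟨hη.1, hηcl⟩)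
  rw [hk η hη.1 hηcl Dη hDη, hk ξ hξ hξcl Dξ hDξ]
  exact hU η hη.2 hηcl hη.1 Dη hDη Dξ hDξ

/-- **ON A CLASS MEMBER, THE SLOT OF RECORD `invOfChoiceBot c` (row 019 m)**: for `E` standard with `0 < Ê.b` over a perfect field, a family `ed` of edge data of `Ê`,
`Ě` with `IsCoreFocus_inst Ê Ě ed`, and ANY choice `c`: H:hEquiCheckLoc at `Ě` with `kit.inv := S16Proof.invOfChoiceBot c` ⟺ `EquiInvLocAt` at R1 — both guards
read off the member (p511607 `spanFinrank_maximalIdeal_eq_of_isCoreFocus`, `isStandard_of_isCoreFocus_baseHike`); no I:`dim Z = n`. Kernel plumbing; NOT a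
statement of the manuscript. [folklore] -/
theorem slot_invOfChoiceBot_iff_equiInvLocAt_of_isCoreFocus_inst [PerfectField K] (c : S16Proof.EdgeChoice.{u} p n) (A : AmbientDatum p K)
    (E : IdealExponent A.Z) (hE : E.IsStandard) (hb : 0 < (baseHike E).b) (ed : EdgeDataOn p n (baseHike E)) {Echeck : IdealExponent A.Z}
    (hEc : IsCoreFocus_inst (baseHike E) Echeck ed) :
    (∀ ξ ∈ Echeck.sing, IsClosed ({ξ} : Set A.Z) → ∃ U : Set A.Z, IsOpen U ∧ ξ ∈ U ∧
      ∀ η ∈ Echeck.sing ∩ U, IsClosed ({η} : Set A.Z) → S16Proof.invOfChoiceBot c Echeck η = S16Proof.invOfChoiceBot c Echeck ξ) ↔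
    EquiInvLocAt CampaignW31.edgeDataProvenance A n Echeck :=
  have hcf : IsCoreFocus S04CharAlgebra.pAlg (invInst (baseHike E) ed) (baseHike E) Echeck := hEc
  have hk : ∀ (η : A.Z), η ∈ Echeck.sing → η ∈ S02Preliminaries.closedPoints A.Z →
      ∀ D : EdgeDatumAt p n Echeck η, S04CharAlgebra.IsEdgeData D → S16Proof.invOfChoiceBot c Echeck η = S04CharAlgebra.inv D :=
    fun _ hη hηcl D hD => S16Proof.invOfChoiceBot_eq_inv_of_isEdgeData c Echeck hη hηcl D hD
  ⟨equiInvLocAt_of_slot A _ Echeck hk,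
    slot_of_equiInvLocAt A _ Echeck (isStandard_of_isCoreFocus_baseHike A (invInst (baseHike E) ed) E hE.1 hb hcf)
      (fun _ hξ => spanFinrank_maximalIdeal_eq_of_isCoreFocus A (invInst (baseHike E) ed) (baseHike E) ed hcf hξ) hk⟩

/-- **… hence ⟺ ⟨SingRegular(Ě)⟩** (p511607 `equiInvLocAt_iff_isRegular_sing_of_isCoreFocus_inst`): on a class member, H:hEquiCheckLoc at the slot of record
`invOfChoiceBot c` holds at the typed core focus `Ě` IFF `Sing(Ě)` is regular — p506310 §3 without its `hn : dim Z = n`. Kernel plumbing; NOT a statement of the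
manuscript. [folklore] -/
theorem slot_invOfChoiceBot_iff_isRegular_sing_of_isCoreFocus_inst [PerfectField K] (c : S16Proof.EdgeChoice.{u} p n) (A : AmbientDatum p K)
    (E : IdealExponent A.Z) (hE : E.IsStandard) (hb : 0 < (baseHike E).b) (ed : EdgeDataOn p n (baseHike E)) {Echeck : IdealExponent A.Z}
    (hEc : IsCoreFocus_inst (baseHike E) Echeck ed) :
    (∀ ξ ∈ Echeck.sing, IsClosed ({ξ} : Set A.Z) → ∃ U : Set A.Z, IsOpen U ∧ ξ ∈ U ∧
      ∀ η ∈ Echeck.sing ∩ U, IsClosed ({η} : Set A.Z) → S16Proof.invOfChoiceBot c Echeck η = S16Proof.invOfChoiceBot c Echeck ξ) ↔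
    Scheme.IsRegular (vanishingIdeal (⟨Echeck.sing, A.isClosed_sing Echeck⟩ : Closeds A.Z)).subscheme :=
  (slot_invOfChoiceBot_iff_equiInvLocAt_of_isCoreFocus_inst c A E hE hb ed hEc).trans
    (equiInvLocAt_iff_isRegular_sing_of_isCoreFocus_inst A E hE hb ed hEc (fun _ _ h => h) (fun _ _ h => h))

/-- **The `invOfChoice c` twin (row 019 e).** Kernel plumbing; NOT a statement of the manuscript. [folklore] -/
theorem slot_invOfChoice_iff_equiInvLocAt_of_isCoreFocus_inst [PerfectField K] (c : S16Proof.EdgeChoice.{u} p n) (A : AmbientDatum p K)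
    (E : IdealExponent A.Z) (hE : E.IsStandard) (hb : 0 < (baseHike E).b) (ed : EdgeDataOn p n (baseHike E)) {Echeck : IdealExponent A.Z}
    (hEc : IsCoreFocus_inst (baseHike E) Echeck ed) :
    (∀ ξ ∈ Echeck.sing, IsClosed ({ξ} : Set A.Z) → ∃ U : Set A.Z, IsOpen U ∧ ξ ∈ U ∧
      ∀ η ∈ Echeck.sing ∩ U, IsClosed ({η} : Set A.Z) → S16Proof.invOfChoice c Echeck η = S16Proof.invOfChoice c Echeck ξ) ↔
    EquiInvLocAt CampaignW31.edgeDataProvenance A n Echeck :=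
  have hcf : IsCoreFocus S04CharAlgebra.pAlg (invInst (baseHike E) ed) (baseHike E) Echeck := hEc
  have hk : ∀ (η : A.Z), η ∈ Echeck.sing → η ∈ S02Preliminaries.closedPoints A.Z →
      ∀ D : EdgeDatumAt p n Echeck η, S04CharAlgebra.IsEdgeData D → S16Proof.invOfChoice c Echeck η = S04CharAlgebra.inv D :=
    fun _ hη hηcl D hD => S16Proof.invOfChoice_eq_inv_of_isEdgeData c Echeck hη hηcl D hD
  ⟨equiInvLocAt_of_slot A _ Echeck hk,
    slot_of_equiInvLocAt A _ Echeck (isStandard_of_isCoreFocus_baseHike A (invInst (baseHike E) ed) E hE.1 hb hcf)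
      (fun _ hξ => spanFinrank_maximalIdeal_eq_of_isCoreFocus A (invInst (baseHike E) ed) (baseHike E) ed hcf hξ) hk⟩

/-- **The `invOfChoice c` twin ⟺ ⟨SingRegular(Ě)⟩.** Kernel plumbing; NOT a statement of the manuscript. [folklore] -/
theorem slot_invOfChoice_iff_isRegular_sing_of_isCoreFocus_inst [PerfectField K] (c : S16Proof.EdgeChoice.{u} p n) (A : AmbientDatum p K)
    (E : IdealExponent A.Z) (hE : E.IsStandard) (hb : 0 < (baseHike E).b) (ed : EdgeDataOn p n (baseHike E)) {Echeck : IdealExponent A.Z}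
    (hEc : IsCoreFocus_inst (baseHike E) Echeck ed) :
    (∀ ξ ∈ Echeck.sing, IsClosed ({ξ} : Set A.Z) → ∃ U : Set A.Z, IsOpen U ∧ ξ ∈ U ∧
      ∀ η ∈ Echeck.sing ∩ U, IsClosed ({η} : Set A.Z) → S16Proof.invOfChoice c Echeck η = S16Proof.invOfChoice c Echeck ξ) ↔
    Scheme.IsRegular (vanishingIdeal (⟨Echeck.sing, A.isClosed_sing Echeck⟩ : Closeds A.Z)).subscheme :=
  (slot_invOfChoice_iff_equiInvLocAt_of_isCoreFocus_inst c A E hE hb ed hEc).trans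
    (equiInvLocAt_iff_isRegular_sing_of_isCoreFocus_inst A E hE hb ed hEc (fun _ _ h => h) (fun _ _ h => h))

end Slot

/-! ## §2 The global one-value reading of Eq. (125) (labelled [reading]; no definition, no door) -/
section Global

variable {IsEdgeData' : ∀ ⦃X : Scheme.{u}⦄ ⦃p n : ℕ⦄ (E : IdealExponent X) (ξ : X), EdgeDatumAt p n E ξ → Prop}
  {p : ℕ} [Fact p.Prime] {K : Type u} [Field K] [CharP K p] {n : ℕ}

/-- **GLOBAL ⇒ LOCAL** [reading]: the literal one-value clause of Eq. (125) «`inv D_ξ = inv D_ξ₂` for all closed `ξ, ξ₂ ∈ Sing(Ě)` and all data in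
`IsEdgeData'`» (p498089's H:hEquiCheck at one stage, data-read form) implies `EquiInvLocAt IsEdgeData' A n Ě` (`U := ⊤`). Kernel plumbing; NOT a statement of
the manuscript. [folklore] -/
theorem equiInvLocAt_of_forall_inv_eq (A : AmbientDatum p K) (Echeck : IdealExponent A.Z)
    (h : ∀ (ξ : A.Z), ξ ∈ Echeck.sing → ξ ∈ S02Preliminaries.closedPoints A.Z → ∀ (ξ₂ : A.Z), ξ₂ ∈ Echeck.sing →
      ξ₂ ∈ S02Preliminaries.closedPoints A.Z → ∀ D : EdgeDatumAt p n Echeck ξ, IsEdgeData' Echeck ξ D →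
        ∀ D₂ : EdgeDatumAt p n Echeck ξ₂, IsEdgeData' Echeck ξ₂ D₂ → S04CharAlgebra.inv D = S04CharAlgebra.inv D₂) :
    EquiInvLocAt IsEdgeData' A n Echeck :=
  fun ξ hξ hξcl => ⟨⊤, trivial, fun η _ hηcl hη Dη hDη Dξ hDξ => h η hη hηcl ξ hξ hξcl Dη hDη Dξ hDξ⟩

/-- **⟨SingRegular(Ě)⟩ + CONSTANT CODIMENSION ⇒ THE GLOBAL ONE-VALUE CLAUSE** [reading] at a typed core focus (any reading `inv`, `0 < Ê.b`; read data implying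
R1): if `ht 𝓘_{Sing Ě, ξ}` takes one value over the closed points of `Sing(Ě)` (the side-datum «equicodimensionality of `Σ̄_max`», res-adj-3 07:33:21Z READING
NOTE), then all certified data at all closed singular points carry the same `inv` (p506310 `inv_eq_inv_of_height_eq_of_isCoreFocus_of_isRegular`). Kernel
plumbing; NOT a statement of the manuscript. [folklore] -/
theorem forall_inv_eq_of_isRegular_sing_of_height_eq (A : AmbientDatum p K) (inv : IdealExponent A.Z → A.Z → EdgeInv n)
    (Ehat : IdealExponent A.Z) (hd : 0 < Ehat.b) {Echeck : IdealExponent A.Z} (hcf : IsCoreFocus S04CharAlgebra.pAlg inv Ehat Echeck)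
    (hR1 : ∀ (η : A.Z) (D : EdgeDatumAt p n Echeck η), IsEdgeData' Echeck η D → S04CharAlgebra.IsEdgeData D)
    (hreg : Scheme.IsRegular (vanishingIdeal (⟨Echeck.sing, A.isClosed_sing Echeck⟩ : Closeds A.Z)).subscheme)
    (hht : ∀ (ξ : A.Z), ξ ∈ Echeck.sing → ξ ∈ S02Preliminaries.closedPoints A.Z → ∀ (ξ₂ : A.Z), ξ₂ ∈ Echeck.sing →
      ξ₂ ∈ S02Preliminaries.closedPoints A.Z →
        (stalkIdeal (vanishingIdeal (⟨Echeck.sing, A.isClosed_sing Echeck⟩ : Closeds A.Z)) ξ).height =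
          (stalkIdeal (vanishingIdeal (⟨Echeck.sing, A.isClosed_sing Echeck⟩ : Closeds A.Z)) ξ₂).height) :
    ∀ (ξ : A.Z), ξ ∈ Echeck.sing → ξ ∈ S02Preliminaries.closedPoints A.Z → ∀ (ξ₂ : A.Z), ξ₂ ∈ Echeck.sing →
      ξ₂ ∈ S02Preliminaries.closedPoints A.Z → ∀ D : EdgeDatumAt p n Echeck ξ, IsEdgeData' Echeck ξ D →
        ∀ D₂ : EdgeDatumAt p n Echeck ξ₂, IsEdgeData' Echeck ξ₂ D₂ → S04CharAlgebra.inv D = S04CharAlgebra.inv D₂ :=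
  fun ξ hξ hξcl ξ₂ hξ₂ hξ₂cl D hD D₂ hD₂ =>
    inv_eq_inv_of_height_eq_of_isCoreFocus_of_isRegular A inv Ehat hd hcf hreg hξ hξ₂ D (hR1 ξ D hD) D₂ (hR1 ξ₂ D₂ hD₂)
      (hht ξ hξ hξcl ξ₂ hξ₂ hξ₂cl)

/-- **⟨SingRegular(Ě)⟩ + IRREDUCIBLE `Sing(Ě)` ⇒ THE GLOBAL ONE-VALUE CLAUSE** [reading]: the side-datum of the previous theorem is automatic when `Sing(Ě)` is
irreducible (res-D-pv-050 `AmbientDatum.height_stalkIdeal_vanishingIdeal_eq_of_isIrreducible`, Lib/RegularCentreCodim). Kernel plumbing; NOT a statement of the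
manuscript. [folklore] -/
theorem forall_inv_eq_of_isRegular_sing_of_isIrreducible (A : AmbientDatum p K) (inv : IdealExponent A.Z → A.Z → EdgeInv n)
    (Ehat : IdealExponent A.Z) (hd : 0 < Ehat.b) {Echeck : IdealExponent A.Z} (hcf : IsCoreFocus S04CharAlgebra.pAlg inv Ehat Echeck)
    (hR1 : ∀ (η : A.Z) (D : EdgeDatumAt p n Echeck η), IsEdgeData' Echeck η D → S04CharAlgebra.IsEdgeData D)
    (hreg : Scheme.IsRegular (vanishingIdeal (⟨Echeck.sing, A.isClosed_sing Echeck⟩ : Closeds A.Z)).subscheme)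
    (hirr : IsIrreducible Echeck.sing) :
    ∀ (ξ : A.Z), ξ ∈ Echeck.sing → ξ ∈ S02Preliminaries.closedPoints A.Z → ∀ (ξ₂ : A.Z), ξ₂ ∈ Echeck.sing →
      ξ₂ ∈ S02Preliminaries.closedPoints A.Z → ∀ D : EdgeDatumAt p n Echeck ξ, IsEdgeData' Echeck ξ D →
        ∀ D₂ : EdgeDatumAt p n Echeck ξ₂, IsEdgeData' Echeck ξ₂ D₂ → S04CharAlgebra.inv D = S04CharAlgebra.inv D₂ :=
  forall_inv_eq_of_isRegular_sing_of_height_eq A inv Ehat hd hcf hR1 hreg fun _ hξ hξcl _ hξ₂ hξ₂cl =>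
    A.height_stalkIdeal_vanishingIdeal_eq_of_isIrreducible ⟨Echeck.sing, A.isClosed_sing Echeck⟩ hreg hirr ⟨hξ, hξcl⟩ ⟨hξ₂, hξ₂cl⟩

end Global

end CampaignW36

end Summit.ResolutionOfSingularities.ResolutionOfSingularities.Theorems

end
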